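import Literature.Analysis.FluidPDE.NSSpinHeatEquationProofs
import Literature.Analysis.FluidPDE.HeatForwardKernels
import Literature.Analysis.FluidPDE.CaloricDuhamelRepresentation
import Literature.Analysis.FluidPDE.CaloricDualityTerms
import Literature.Analysis.FluidPDE.CaloricTestFieldCalculus
import Literature.Analysis.Convolution.YoungInequality
import Mathlib.Analysis.Distribution.AEEqOfIntegralContDiff
import HarnessLib

/-!
# The interior `L^m → L^r` improvement for `∂ₜw - Δw = div g` — proofs

Analysis/FluidPDE proofs file: it **discharges** the named fact
`Literature.Analysis.FluidPDE.HeatDivFormInteriorImprovement` (`NSBoundedVorticityReduction.lean`;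
Robinson–Rodrigo–Sadowski 2016, proof of Thm. 13.7, §13.3.2 Step 2 with Thms. D.6–D.7 in the
isotropic case `m = m'`, `r = r'`): if `w, g ∈ L^m(Q*_ρ(z))` satisfy `∂ₜw - Δw = div g` in
`𝒟'(Q*_ρ(z))`, `1 < m ≤ r ≤ ∞`, `1/m < 1/r + 1/5`, `0 < ρ' < ρ`, then `w ∈ L^r(Q*_{ρ'}(z))`
(`HeatDivFormInteriorImprovement_holds`). Together with `NSSpinHeatEquation_holds` this completes
the decomposition of `NSBoundedVorticityBounded` (assembled in `NSBoundedSpatialHolderProofs`).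

## Proof (RRS 2016, §13.3.2 Steps 1–2, pp. 185–187, and App. D; all steps proved here)

1. *Extension and localisation.* Extend `w, g` by zero off the cylinder `Q = Q*_ρ(z)` (the weak
   equation only sees `Q`) and fix a cut-off `φ ∈ C_c^∞(Q)` with `φ = 1` on `Q*_{ρ'}(z)`
   (`exists_cylinder_cutoff`, a product of Mathlib bump functions).
2. *Duality.* For `Θ ∈ C_c^∞(ℝ × ℝ³)` let `U = 𝒰[Θ]` be the backward caloric Duhamel integral
   of the tree (`heatDuhamelBack 1 Θ`, `∂ₜU + ΔU = -Θ`). Testing the equation with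
   `ψ = φU ∈ C_c^∞(Q)` and expanding (13.11),
   `∂ₜ(φU) + Δ(φU) = -φΘ + U(∂ₜφ + Δφ) + 2⟪∇φ, ∇U⟫`, `∇(φU) = φ∇U + U∇φ`, gives
   `∫ φwΘ = ∫ H U - ∫ ⟪F, ∇U⟫` with `H = w(∂ₜφ + Δφ) - ⟪g, ∇φ⟫`, `F = φg - 2w∇φ ∈ L^m` — the
   data of RRS (13.12) (`integral_cutoff_mul_mul_test_eq`).
3. *Representation.* `U = K ⋆ Θ̃`, `∂ᵢU = Kᵢ ⋆ Θ̃` with the backward heat kernel `K` and its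
   gradient kernels `Kᵢ` (`CaloricDuhamelRepresentation`), so by Fubini
   `∫ φwΘ̃ = ∫ Θ̃ (Φ ⋆ H - Σᵢ Φᵢ ⋆ Fᵢ)` with the forward kernels `Φ = Ǩ`, `Φᵢ = Ǩᵢ`
   (`HeatForwardKernels.fwdKernel`): the localised solution **is** the Duhamel potential of
   RRS (D.2) in `𝒟'` (`integral_cutoff_mul_mul_test_eq_potentials`; the absolute convergence for
   the integrable — not bounded — data is `integrable_pairing_of_integrable_data`, the swap of the
   tree's bounded-data pairing).
4. *Truncation and Young.* On the half-space `{t < c} ⊇ Q` the kernels may be truncated in time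
   (`integral_test_mul_fwd_eq_fwdCut`); the truncated kernels lie in `L^p(ℝ × ℝ³)` for
   `1 ≤ p < 5/4` (`memLp_fwdKernelCut_heatKernel[Grad]`), and for the exponent `p` with
   `1/p + 1/m = 1 + 1/r` (`exists_kernel_exponent`; `p < 5/4 ⇔ 1/m < 1/r + 1/5`, RRS's
   `5/m < 5/r + 1`) Young's inequality (`Convolution.memLp_convolution_of_memLp`, RRS Thm. A.10)
   puts the potentials in `L^r` — the content of RRS Thms. D.6–D.7 in the isotropic case.
5. *Conclusion.* By du Bois-Reymond (`IsOpen.ae_eq_zero_of_integral_contDiff_smul_eq_zero`)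
   `φw` agrees a.e. on `{t < c}` with the `L^r` potential, and `φw = w` on `Q*_{ρ'}(z)`.

## Contents

* tools: continuity of slice derivatives of jointly smooth fields, integrability / `MemLp` of
  `L¹`/`L^m` data times continuous compactly supported factors;
* `locH`, `locF` (the data of (13.12)) with their supports, integrability and `MemLp`;
* `integral_cutoff_mul_mul_test_eq` (step 2), `integral_mul_conv_eq_integral_test_mul_fwd`
  (adjoint pairing with integrable data), `integral_cutoff_mul_mul_test_eq_potentials` (step 3),
  `integral_test_mul_fwd_eq_fwdCut` (step 4), `exists_kernel_exponent`, `exists_cylinder_cutoff`;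
* `HeatDivFormInteriorImprovement_holds`.

## References

* J. C. Robinson, J. L. Rodrigo, W. Sadowski, *The Three-Dimensional Navier–Stokes Equations.
  Classical theory*, CUP 2016: §13.3.2 Steps 1–2, (13.11)–(13.17) (pp. 185–187 of the held
  copy); App. D, (D.2), Thm. D.4, Thms. D.6–D.7 (pp. 291–296); App. A, Thm. A.10.
  [`RobinsonRodrigoSadowskiCUP2016`]
* L. C. Evans, *Partial Differential Equations*, 2nd ed., AMS 2010, §2.3.1 (Duhamel's
  principle). [`Evans2010`]
-/

noncomputable section

open MeasureTheory Set Function Filter Topology TopologicalSpace Metric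
open scoped NNReal ENNReal RealInnerProductSpace Laplacian Convolution

namespace Literature.Analysis.FluidPDE

namespace HeatDivForm

section General

variable {E : Type*} [NormedAddCommGroup E] [InnerProductSpace ℝ E] [FiniteDimensional ℝ E]
  [MeasurableSpace E] [BorelSpace E]

/-! ### Small calculus and integrability tools -/

omit [MeasurableSpace E] [BorelSpace E] [FiniteDimensional ℝ E] in
/-- `⟪v, ∇f(x)⟫ = Df(x) v` [complete `E`]. [folklore] -/
theorem real_inner_gradient_right [CompleteSpace E] (f : E → ℝ) (x v : E) :
    ⟪v, gradient f x⟫ = fderiv ℝ f x v := by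
  rw [real_inner_comm, gradient, InnerProductSpace.toDual_symm_apply]

/-- An integrable function times a continuous compactly supported function is integrable. [folklore] -/
theorem integrable_mul_of_continuous_hasCompactSupport {m c : ℝ × E → ℝ}
    (hm : Integrable m (volume : Measure (ℝ × E))) (hc : Continuous c) (hcs : HasCompactSupport c) :
    Integrable (fun q => m q * c q) (volume : Measure (ℝ × E)) := by
  obtain ⟨C, hC⟩ := hc.bounded_above_of_compact_support hcs
  exact hm.mul_bdd hc.aestronglyMeasurable (Eventually.of_forall hC)

omit [MeasurableSpace E] [BorelSpace E] [FiniteDimensional ℝ E] in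
/-- Spatial slice derivatives of a jointly smooth field are jointly continuous. [folklore] -/
theorem continuous_fderiv_slice_apply_of_contDiff {H : ℝ → E → ℝ}
    (hH : ContDiff ℝ ((⊤ : ℕ∞) : WithTop ℕ∞) (uncurry H)) (v : E) :
    Continuous fun q : ℝ × E => fderiv ℝ (H q.1) q.2 v := by
  have h := (IsSmoothSpaceTimeOn.isSmoothSpaceTimeOn_fderiv_apply (S := univ) (w := H)
    (by rw [IsSmoothSpaceTimeOn, univ_prod_univ, contDiffOn_univ]; exact hH) isOpen_univ v)
  rw [IsSmoothSpaceTimeOn, univ_prod_univ, contDiffOn_univ] at h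
  exact h.continuous

omit [MeasurableSpace E] [BorelSpace E] [FiniteDimensional ℝ E] in
/-- The time derivative of a jointly smooth field is jointly continuous. [folklore] -/
theorem continuous_timeDeriv_of_contDiff {H : ℝ → E → ℝ}
    (hH : ContDiff ℝ ((⊤ : ℕ∞) : WithTop ℕ∞) (uncurry H)) :
    Continuous fun q : ℝ × E => timeDeriv H q.1 q.2 := by
  have h := (IsSmoothSpaceTimeOn.isSmoothSpaceTimeOn_deriv (S := univ) (w := H)
    (by rw [IsSmoothSpaceTimeOn, univ_prod_univ, contDiffOn_univ]; exact hH) isOpen_univ)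
  rw [IsSmoothSpaceTimeOn, univ_prod_univ, contDiffOn_univ] at h
  exact h.continuous

omit [MeasurableSpace E] [BorelSpace E] in
/-- The slice Laplacian of a jointly smooth field is jointly continuous. [folklore] -/
theorem continuous_laplacian_slice_of_contDiff {H : ℝ → E → ℝ}
    (hH : ContDiff ℝ ((⊤ : ℕ∞) : WithTop ℕ∞) (uncurry H)) :
    Continuous fun q : ℝ × E => (Δ (H q.1)) q.2 := by
  set b := stdOrthonormalBasis ℝ E
  have h2 : ∀ t, ContDiff ℝ 2 (H t) := fun t => (contDiff_slice_of_uncurry hH t).of_le two_le_infty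
  have heq : (fun q : ℝ × E => (Δ (H q.1)) q.2) =
      fun q => ∑ i, fderiv ℝ (fun y => fderiv ℝ (H q.1) y (b i)) q.2 (b i) := by
    funext q
    exact laplacian_eq_sum_fderiv_fderiv_normed b (h2 q.1) q.2
  rw [heq]
  refine continuous_finsetSum _ fun i _ => ?_
  have h1 : ContDiff ℝ ((⊤ : ℕ∞) : WithTop ℕ∞) (uncurry fun t y => fderiv ℝ (H t) y (b i)) := by
    have h := (IsSmoothSpaceTimeOn.isSmoothSpaceTimeOn_fderiv_apply (S := univ) (w := H)
      (by rw [IsSmoothSpaceTimeOn, univ_prod_univ, contDiffOn_univ]; exact hH) isOpen_univ (b i))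
    rw [IsSmoothSpaceTimeOn, univ_prod_univ, contDiffOn_univ] at h
    exact h
  exact continuous_fderiv_slice_apply_of_contDiff h1 (b i)

/-! ### The localised data -/

variable {ι : Type*} [Fintype ι]

/-- The scalar datum of the localised equation:
`locH b φ w g = w (∂ₜφ + Δφ) - Σᵢ ⟪g, bᵢ⟫ ∂ᵢφ` (`= w(∂ₜφ + Δφ) - ⟪g, ∇φ⟫`; Robinson–Rodrigo–Sadowski
2016, (13.12), the terms `-(∂ⱼφ)(…) + (∂ₜφ + Δφ)ωᵢ`). [folklore] -/
def locH (b : OrthonormalBasis ι ℝ E) (φ : ℝ → E → ℝ) (w : ℝ × E → ℝ) (g : ℝ × E → E)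
    (q : ℝ × E) : ℝ :=
  w q * (timeDeriv φ q.1 q.2 + (Δ (φ q.1)) q.2) - ∑ i, ⟪g q, b i⟫ * fderiv ℝ (φ q.1) q.2 (b i)

/-- The `i`-th coordinate of the vector datum of the localised equation:
`locF b φ w g i = φ ⟪g, bᵢ⟫ - 2 w ∂ᵢφ` (`F = φg - 2w∇φ`; RRS 2016, (13.12), the terms
`∂ⱼ(φ…) - 2∂ⱼ((∂ⱼφ)ωᵢ)`). [folklore] -/
def locF (b : OrthonormalBasis ι ℝ E) (φ : ℝ → E → ℝ) (w : ℝ × E → ℝ) (g : ℝ × E → E) (i : ι)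
    (q : ℝ × E) : ℝ :=
  φ q.1 q.2 * ⟪g q, b i⟫ - 2 * w q * fderiv ℝ (φ q.1) q.2 (b i)

/-! ### The duality identity `∫ φ w Θ = ∫ H·𝒰[Θ] - Σᵢ ∫ Fᵢ ∂ᵢ𝒰[Θ]` -/

/-- **Localisation and duality in one step** (Robinson–Rodrigo–Sadowski 2016, §13.3.2 Step 1,
(13.11)–(13.12), tested against the backward caloric Duhamel integral). Let `w, g` be integrable
on `ℝ × E` and satisfy `∂ₜw - Δw = div g` weakly on the open set `Q`
(`∫ w (∂ₜψ + Δψ) = ∫ ⟪g, ∇ψ⟫` for `ψ ∈ C_c^∞(Q)`), let `φ ∈ C_c^∞(Q)` and `Θ ∈ C_c^∞(ℝ × E)`,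
`U = 𝒰[Θ] = heatDuhamelBack 1 Θ` (so `∂ₜU + ΔU = -Θ`). Testing the equation with `ψ = φU ∈ C_c^∞(Q)`
and expanding `∂ₜ(φU) + Δ(φU) = -φΘ + U(∂ₜφ + Δφ) + 2Σᵢ ∂ᵢφ ∂ᵢU`,
`⟪g, ∇(φU)⟫ = Σᵢ ⟪g, bᵢ⟫(∂ᵢφ U + φ ∂ᵢU)` gives
`∫ φ w Θ = ∫ locH·U - Σᵢ ∫ locFᵢ ∂ᵢU`. [cite: RobinsonRodrigoSadowskiCUP2016, §13.3.2 Step 1, (13.11)–(13.12)] -/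
theorem integral_cutoff_mul_mul_test_eq (b : OrthonormalBasis ι ℝ E) {Q : Opens (ℝ × E)}
    {w : ℝ × E → ℝ} {g : ℝ × E → E} (hw : Integrable w (volume : Measure (ℝ × E)))
    (hg : Integrable g (volume : Measure (ℝ × E)))
    (heq : ∀ ψ : ℝ → E → ℝ, IsSpaceTimeTestOn Q ψ →
      ∫ q : ℝ × E, w q * (timeDeriv ψ q.1 q.2 + (Δ (ψ q.1)) q.2) =
        ∫ q : ℝ × E, ⟪g q, gradient (ψ q.1) q.2⟫)
    {φ : ℝ → E → ℝ} (hφ : IsSpaceTimeTestOn Q φ) {Θ : ℝ → E → ℝ}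
    (hΘ : IsSpaceTimeTestOn (⊤ : Opens (ℝ × E)) Θ) :
    ∫ q : ℝ × E, φ q.1 q.2 * w q * Θ q.1 q.2 =
      (∫ q : ℝ × E, locH b φ w g q * heatDuhamelBack 1 Θ q.1 q.2) -
        ∑ i, ∫ q : ℝ × E, locF b φ w g i q * fderiv ℝ (heatDuhamelBack 1 Θ q.1) q.2 (b i) := by
  set U : ℝ → E → ℝ := heatDuhamelBack 1 Θ with hU
  have hUs : ContDiff ℝ ((⊤ : ℕ∞) : WithTop ℕ∞) (uncurry U) :=
    hΘ.contDiff_uncurry_heatDuhamelBack_infty one_pos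
  have hφs : ContDiff ℝ ((⊤ : ℕ∞) : WithTop ℕ∞) (uncurry φ) := hφ.contDiff
  -- the test function `ψ = φ U`
  have hψ : IsSpaceTimeTestOn Q (fun t x => φ t x * U t x) := hφ.mul_smooth hUs
  have key := heq _ hψ
  -- pointwise expansions
  have hφ2 : ∀ t, ContDiff ℝ 2 (φ t) := fun t => (hφ.contDiff_slice t).of_le two_le_infty
  have hU2 : ∀ t, ContDiff ℝ 2 (U t) := fun t => (contDiff_slice_of_uncurry hUs t).of_le two_le_infty
  have hheat : ∀ t x, timeDeriv U t x + (Δ (U t)) x = -Θ t x := fun t x =>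
    timeDeriv_add_laplacian_heatDuhamelBack_one hΘ t x
  have hL : ∀ q : ℝ × E, w q * (timeDeriv (fun t x => φ t x * U t x) q.1 q.2 +
      (Δ (fun x => φ q.1 x * U q.1 x)) q.2) =
      -(φ q.1 q.2 * w q * Θ q.1 q.2) +
        w q * ((timeDeriv φ q.1 q.2 + (Δ (φ q.1)) q.2) * U q.1 q.2) +
        2 * ∑ i, w q * (fderiv ℝ (φ q.1) q.2 (b i) * fderiv ℝ (U q.1) q.2 (b i)) := by
    rintro ⟨t, x⟩
    have e1 : timeDeriv (fun t x => φ t x * U t x) t x =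
        timeDeriv φ t x * U t x + φ t x * timeDeriv U t x :=
      timeDeriv_mul (differentiableAt_time_of_uncurry hφs (by simp) t x)
        (differentiableAt_time_of_uncurry hUs (by simp) t x)
    have e2 := laplacian_mul_eq b (hφ2 t) (hU2 t) x
    have hs : ∑ i, w (t, x) * (fderiv ℝ (φ t) x (b i) * fderiv ℝ (U t) x (b i)) =
        w (t, x) * ∑ i, fderiv ℝ (φ t) x (b i) * fderiv ℝ (U t) x (b i) := by
      rw [Finset.mul_sum]
    simp only
    rw [e1, e2, hs]
    have := hheat t x
    have e3 : φ t x * timeDeriv U t x + φ t x * (Δ (U t)) x = -(φ t x * Θ t x) := by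
      rw [← mul_add, this, mul_neg]
    linear_combination w (t, x) * e3
  have hR : ∀ q : ℝ × E, ⟪g q, gradient (fun x => φ q.1 x * U q.1 x) q.2⟫ =
      ∑ i, ⟪g q, b i⟫ * (fderiv ℝ (φ q.1) q.2 (b i) * U q.1 q.2) +
        ∑ i, ⟪g q, b i⟫ * (φ q.1 q.2 * fderiv ℝ (U q.1) q.2 (b i)) := by
    rintro ⟨t, x⟩
    have hφd : DifferentiableAt ℝ (φ t) x := ((hφ.contDiff_slice t).differentiable (by simp)) x
    have hUd : DifferentiableAt ℝ (U t) x :=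
      ((contDiff_slice_of_uncurry hUs t).differentiable (by simp)) x
    simp only
    rw [real_inner_gradient_right, fderiv_apply_eq_sum_inner b, ← Finset.sum_add_distrib]
    refine Finset.sum_congr rfl fun i _ => ?_
    rw [fderiv_fun_mul hφd hUd]
    simp only [_root_.add_apply, FunLike.coe_smul, Pi.smul_apply, smul_eq_mul]
    ring
  simp_rw [hL, hR] at key
  -- continuity and compact support of the smooth factors
  have cU : Continuous fun q : ℝ × E => U q.1 q.2 := hUs.continuous
  have cdU : ∀ i, Continuous fun q : ℝ × E => fderiv ℝ (U q.1) q.2 (b i) := fun i =>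
    continuous_fderiv_slice_apply_of_contDiff hUs (b i)
  have cφ : Continuous fun q : ℝ × E => φ q.1 q.2 := hφs.continuous
  have cdφ : ∀ i, Continuous fun q : ℝ × E => fderiv ℝ (φ q.1) q.2 (b i) := fun i =>
    continuous_fderiv_slice_apply_of_contDiff hφs (b i)
  have cχ : Continuous fun q : ℝ × E => timeDeriv φ q.1 q.2 + (Δ (φ q.1)) q.2 :=
    (continuous_timeDeriv_of_contDiff hφs).add (continuous_laplacian_slice_of_contDiff hφs)
  have cΘ : Continuous fun q : ℝ × E => Θ q.1 q.2 := hΘ.contDiff.continuous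
  have sφ : HasCompactSupport fun q : ℝ × E => φ q.1 q.2 := hφ.hasCompactSupport
  have sdφ : ∀ i, HasCompactSupport fun q : ℝ × E => fderiv ℝ (φ q.1) q.2 (b i) := fun i =>
    ((hφ.mono le_top).fderiv_apply_top (b i)).hasCompactSupport
  have sχ : HasCompactSupport fun q : ℝ × E => timeDeriv φ q.1 q.2 + (Δ (φ q.1)) q.2 :=
    (hφ.mono le_top).timeDeriv_top.hasCompactSupport.add (hφ.mono le_top).laplacian_top.hasCompactSupport
  -- the coordinates of `g` are integrable
  have hgi : ∀ i, Integrable (fun q : ℝ × E => ⟪g q, b i⟫) (volume : Measure (ℝ × E)) := fun i =>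
    hg.inner_const (b i)
  -- integrability of the five kinds of terms
  have I1 : Integrable (fun q : ℝ × E => φ q.1 q.2 * w q * Θ q.1 q.2) (volume : Measure (ℝ × E)) := by
    have h : Integrable (fun q : ℝ × E => w q * (φ q.1 q.2 * Θ q.1 q.2)) (volume : Measure (ℝ × E)) :=
      integrable_mul_of_continuous_hasCompactSupport hw (cφ.mul cΘ) (sφ.mul_right)
    refine h.congr (Eventually.of_forall fun q => ?_)
    simp only; ring
  have I2 : Integrable (fun q : ℝ × E =>
      w q * ((timeDeriv φ q.1 q.2 + (Δ (φ q.1)) q.2) * U q.1 q.2)) (volume : Measure (ℝ × E)) :=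
    integrable_mul_of_continuous_hasCompactSupport hw (cχ.mul cU) sχ.mul_right
  have I3 : ∀ i, Integrable (fun q : ℝ × E =>
      w q * (fderiv ℝ (φ q.1) q.2 (b i) * fderiv ℝ (U q.1) q.2 (b i))) (volume : Measure (ℝ × E)) :=
    fun i => integrable_mul_of_continuous_hasCompactSupport hw ((cdφ i).mul (cdU i)) (sdφ i).mul_right
  have I4 : ∀ i, Integrable (fun q : ℝ × E =>
      ⟪g q, b i⟫ * (fderiv ℝ (φ q.1) q.2 (b i) * U q.1 q.2)) (volume : Measure (ℝ × E)) :=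
    fun i => integrable_mul_of_continuous_hasCompactSupport (hgi i) ((cdφ i).mul cU) (sdφ i).mul_right
  have I5 : ∀ i, Integrable (fun q : ℝ × E =>
      ⟪g q, b i⟫ * (φ q.1 q.2 * fderiv ℝ (U q.1) q.2 (b i))) (volume : Measure (ℝ × E)) :=
    fun i => integrable_mul_of_continuous_hasCompactSupport (hgi i) (cφ.mul (cdU i)) sφ.mul_right
  -- evaluate both sides of `key`
  have I3s : Integrable (fun q : ℝ × E =>
      ∑ i, w q * (fderiv ℝ (φ q.1) q.2 (b i) * fderiv ℝ (U q.1) q.2 (b i))) (volume : Measure (ℝ × E)) :=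
    integrable_finsetSum _ fun i _ => I3 i
  have I3s2 : Integrable (fun q : ℝ × E =>
      2 * ∑ i, w q * (fderiv ℝ (φ q.1) q.2 (b i) * fderiv ℝ (U q.1) q.2 (b i))) (volume : Measure (ℝ × E)) :=
    I3s.const_mul 2
  have hLint : ∫ q : ℝ × E, (-(φ q.1 q.2 * w q * Θ q.1 q.2) +
      w q * ((timeDeriv φ q.1 q.2 + (Δ (φ q.1)) q.2) * U q.1 q.2) +
      2 * ∑ i, w q * (fderiv ℝ (φ q.1) q.2 (b i) * fderiv ℝ (U q.1) q.2 (b i))) =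
      -(∫ q : ℝ × E, φ q.1 q.2 * w q * Θ q.1 q.2) +
        (∫ q : ℝ × E, w q * ((timeDeriv φ q.1 q.2 + (Δ (φ q.1)) q.2) * U q.1 q.2)) +
        2 * ∑ i, ∫ q : ℝ × E, w q * (fderiv ℝ (φ q.1) q.2 (b i) * fderiv ℝ (U q.1) q.2 (b i)) := by
    have I1n : Integrable (fun q : ℝ × E => -(φ q.1 q.2 * w q * Θ q.1 q.2)) (volume : Measure (ℝ × E)) :=
      I1.neg
    have I12 : Integrable (fun q : ℝ × E => -(φ q.1 q.2 * w q * Θ q.1 q.2) +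
        w q * ((timeDeriv φ q.1 q.2 + (Δ (φ q.1)) q.2) * U q.1 q.2)) (volume : Measure (ℝ × E)) :=
      I1n.add I2
    rw [integral_add I12 I3s2, integral_add I1n I2, integral_neg, integral_const_mul,
      integral_finsetSum _ fun i _ => I3 i]
  have hRint : ∫ q : ℝ × E, (∑ i, ⟪g q, b i⟫ * (fderiv ℝ (φ q.1) q.2 (b i) * U q.1 q.2) +
      ∑ i, ⟪g q, b i⟫ * (φ q.1 q.2 * fderiv ℝ (U q.1) q.2 (b i))) =
      (∑ i, ∫ q : ℝ × E, ⟪g q, b i⟫ * (fderiv ℝ (φ q.1) q.2 (b i) * U q.1 q.2)) +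
        ∑ i, ∫ q : ℝ × E, ⟪g q, b i⟫ * (φ q.1 q.2 * fderiv ℝ (U q.1) q.2 (b i)) := by
    rw [integral_add (integrable_finsetSum _ fun i _ => I4 i) (integrable_finsetSum _ fun i _ => I5 i),
      integral_finsetSum _ fun i _ => I4 i, integral_finsetSum _ fun i _ => I5 i]
  rw [hLint, hRint] at key
  -- the right-hand side of the claim
  have IH : Integrable (fun q : ℝ × E => locH b φ w g q * U q.1 q.2) (volume : Measure (ℝ × E)) := by
    have h : Integrable (fun q : ℝ × E => w q * ((timeDeriv φ q.1 q.2 + (Δ (φ q.1)) q.2) * U q.1 q.2) -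
        ∑ i, ⟪g q, b i⟫ * (fderiv ℝ (φ q.1) q.2 (b i) * U q.1 q.2)) (volume : Measure (ℝ × E)) :=
      I2.sub (integrable_finsetSum _ fun i _ => I4 i)
    refine h.congr (Eventually.of_forall fun q => ?_)
    simp only [locH, Finset.sum_mul, sub_mul]
    congr 1
    · ring
    · exact Finset.sum_congr rfl fun i _ => by ring
  have eH : ∫ q : ℝ × E, locH b φ w g q * U q.1 q.2 =
      (∫ q : ℝ × E, w q * ((timeDeriv φ q.1 q.2 + (Δ (φ q.1)) q.2) * U q.1 q.2)) -
        ∑ i, ∫ q : ℝ × E, ⟪g q, b i⟫ * (fderiv ℝ (φ q.1) q.2 (b i) * U q.1 q.2) := by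
    rw [← integral_finsetSum _ fun i _ => I4 i, ← integral_sub I2 (integrable_finsetSum _ fun i _ => I4 i)]
    refine integral_congr_ae (Eventually.of_forall fun q => ?_)
    simp only [locH, Finset.sum_mul, sub_mul]
    congr 1
    · ring
    · exact Finset.sum_congr rfl fun i _ => by ring
  have eF : ∀ i, ∫ q : ℝ × E, locF b φ w g i q * fderiv ℝ (U q.1) q.2 (b i) =
      (∫ q : ℝ × E, ⟪g q, b i⟫ * (φ q.1 q.2 * fderiv ℝ (U q.1) q.2 (b i))) -
        2 * ∫ q : ℝ × E, w q * (fderiv ℝ (φ q.1) q.2 (b i) * fderiv ℝ (U q.1) q.2 (b i)) := by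
    intro i
    rw [← integral_const_mul, ← integral_sub (I5 i) ((I3 i).const_mul 2)]
    refine integral_congr_ae (Eventually.of_forall fun q => ?_)
    simp only [locF]
    ring
  rw [eH, Finset.sum_congr rfl fun i _ => eF i, Finset.sum_sub_distrib, ← Finset.mul_sum]
  linarith [key]

/-! ### Time supports of the localised data -/

omit [MeasurableSpace E] [BorelSpace E] [FiniteDimensional ℝ E] in
/-- The support `K` of the cut-off has bounded time extent: there are `a', b'` with
`K ⊆ [a', b'] × E`. [folklore] -/
theorem exists_time_bounds_of_isSpaceTimeTestOn {Q : Opens (ℝ × E)} {φ : ℝ → E → ℝ}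
    (hφ : IsSpaceTimeTestOn Q φ) :
    ∃ a' b' : ℝ, ∀ q : ℝ × E, q ∈ tsupport (uncurry φ) → q.1 ∈ Icc a' b' := by
  have h1 : IsCompact (Prod.fst '' tsupport (uncurry φ)) := hφ.hasCompactSupport.image continuous_fst
  obtain ⟨b', hb'⟩ := h1.isBounded.bddAbove
  obtain ⟨a', ha'⟩ := h1.isBounded.bddBelow
  exact ⟨a', b', fun q hq => ⟨ha' ⟨q, hq, rfl⟩, hb' ⟨q, hq, rfl⟩⟩⟩

omit [MeasurableSpace E] [BorelSpace E] in
/-- Off the support of the cut-off the localised data vanish. [folklore] -/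
theorem locH_eq_zero_of_notMem (b : OrthonormalBasis ι ℝ E) {φ : ℝ → E → ℝ}
    (w : ℝ × E → ℝ) (g : ℝ × E → E) {q : ℝ × E} (hq : q ∉ tsupport (uncurry φ)) :
    locH b φ w g q = 0 := by
  obtain ⟨t, x⟩ := q
  have h1 : timeDeriv φ t x = 0 := IsSpaceTimeTestOn.timeDeriv_eq_zero_of_notMem hq
  have h2 : (Δ (φ t)) x = 0 := laplacian_slice_eq_zero_of_notMem_tsupport hq
  have h3 : fderiv ℝ (φ t) x = 0 := IsSpaceTimeTestOn.fderiv_slice_eq_zero_of_notMem hq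
  simp only [locH, h1, h2, h3, add_zero, mul_zero, _root_.zero_apply, Finset.sum_const_zero,
    sub_zero]

omit [MeasurableSpace E] [BorelSpace E] [FiniteDimensional ℝ E] in
/-- Off the support of the cut-off the localised data vanish. [folklore] -/
theorem locF_eq_zero_of_notMem (b : OrthonormalBasis ι ℝ E) {φ : ℝ → E → ℝ}
    (w : ℝ × E → ℝ) (g : ℝ × E → E) (i : ι) {q : ℝ × E} (hq : q ∉ tsupport (uncurry φ)) :
    locF b φ w g i q = 0 := by
  obtain ⟨t, x⟩ := q
  have h0' : uncurry φ (t, x) = 0 := image_eq_zero_of_notMem_tsupport hq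
  have h0 : φ t x = 0 := h0'
  have h3 : fderiv ℝ (φ t) x = 0 := IsSpaceTimeTestOn.fderiv_slice_eq_zero_of_notMem hq
  simp only [locF, h0, h3, zero_mul, _root_.zero_apply, mul_zero, sub_zero]

/-- The localised data are integrable (integrable `w, g` times bounded compactly supported
factors). [folklore] -/
theorem integrable_locH (b : OrthonormalBasis ι ℝ E) {Q : Opens (ℝ × E)} {φ : ℝ → E → ℝ}
    (hφ : IsSpaceTimeTestOn Q φ) {w : ℝ × E → ℝ} {g : ℝ × E → E}
    (hw : Integrable w (volume : Measure (ℝ × E))) (hg : Integrable g (volume : Measure (ℝ × E))) :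
    Integrable (locH b φ w g) (volume : Measure (ℝ × E)) := by
  have hφs : ContDiff ℝ ((⊤ : ℕ∞) : WithTop ℕ∞) (uncurry φ) := hφ.contDiff
  have cdφ : ∀ i, Continuous fun q : ℝ × E => fderiv ℝ (φ q.1) q.2 (b i) := fun i =>
    continuous_fderiv_slice_apply_of_contDiff hφs (b i)
  have cχ : Continuous fun q : ℝ × E => timeDeriv φ q.1 q.2 + (Δ (φ q.1)) q.2 :=
    (continuous_timeDeriv_of_contDiff hφs).add (continuous_laplacian_slice_of_contDiff hφs)
  have sdφ : ∀ i, HasCompactSupport fun q : ℝ × E => fderiv ℝ (φ q.1) q.2 (b i) := fun i =>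
    ((hφ.mono le_top).fderiv_apply_top (b i)).hasCompactSupport
  have sχ : HasCompactSupport fun q : ℝ × E => timeDeriv φ q.1 q.2 + (Δ (φ q.1)) q.2 :=
    (hφ.mono le_top).timeDeriv_top.hasCompactSupport.add (hφ.mono le_top).laplacian_top.hasCompactSupport
  have I1 : Integrable (fun q : ℝ × E => w q * (timeDeriv φ q.1 q.2 + (Δ (φ q.1)) q.2))
      (volume : Measure (ℝ × E)) := integrable_mul_of_continuous_hasCompactSupport hw cχ sχ
  have I2 : ∀ i, Integrable (fun q : ℝ × E => ⟪g q, b i⟫ * fderiv ℝ (φ q.1) q.2 (b i))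
      (volume : Measure (ℝ × E)) := fun i =>
    integrable_mul_of_continuous_hasCompactSupport (hg.inner_const (b i)) (cdφ i) (sdφ i)
  exact I1.sub (integrable_finsetSum _ fun i _ => I2 i)

/-- The localised vector data are integrable. [folklore] -/
theorem integrable_locF (b : OrthonormalBasis ι ℝ E) {Q : Opens (ℝ × E)} {φ : ℝ → E → ℝ}
    (hφ : IsSpaceTimeTestOn Q φ) {w : ℝ × E → ℝ} {g : ℝ × E → E}
    (hw : Integrable w (volume : Measure (ℝ × E))) (hg : Integrable g (volume : Measure (ℝ × E)))
    (i : ι) : Integrable (locF b φ w g i) (volume : Measure (ℝ × E)) := by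
  have hφs : ContDiff ℝ ((⊤ : ℕ∞) : WithTop ℕ∞) (uncurry φ) := hφ.contDiff
  have cφ : Continuous fun q : ℝ × E => φ q.1 q.2 := hφs.continuous
  have cdφ : Continuous fun q : ℝ × E => fderiv ℝ (φ q.1) q.2 (b i) :=
    continuous_fderiv_slice_apply_of_contDiff hφs (b i)
  have sφ : HasCompactSupport fun q : ℝ × E => φ q.1 q.2 := hφ.hasCompactSupport
  have sdφ : HasCompactSupport fun q : ℝ × E => fderiv ℝ (φ q.1) q.2 (b i) :=
    ((hφ.mono le_top).fderiv_apply_top (b i)).hasCompactSupport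
  have I1 : Integrable (fun q : ℝ × E => ⟪g q, b i⟫ * φ q.1 q.2) (volume : Measure (ℝ × E)) :=
    integrable_mul_of_continuous_hasCompactSupport (hg.inner_const (b i)) cφ sφ
  have I2 : Integrable (fun q : ℝ × E => w q * fderiv ℝ (φ q.1) q.2 (b i)) (volume : Measure (ℝ × E)) :=
    integrable_mul_of_continuous_hasCompactSupport hw cdφ sdφ
  refine (I1.sub (I2.const_mul 2)).congr (Eventually.of_forall fun q => ?_)
  simp only [locF, Pi.sub_apply]
  ring

/-! ### Adjoint pairings with integrable data -/

/-- **Absolute convergence of the duality pairing, integrable data** (the roles of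
`integrable_kernelPairing_of_sliceBound` swapped: the kernel `K = backKernel κ` of a slice-bound
family, bounded `Θ̃` with bounded time support, and integrable data `D` with bounded time
support): `D(z) K(z - w) Θ̃(w)` is integrable on the product. [folklore] -/
theorem integrable_pairing_of_integrable_data {κ : ℝ → E → ℝ} {N : ℝ → ℝ}
    (hK : IsSliceBoundKernel (backKernel κ) N) {Θ : ℝ → E → ℝ}
    (hΘ : IsSpaceTimeTestOn (⊤ : Opens (ℝ × E)) Θ) {D : ℝ × E → ℝ}
    (hD : Integrable D (volume : Measure (ℝ × E))) {a' b' : ℝ}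
    (hDsupp : ∀ q, D q ≠ 0 → q.1 ∈ Icc a' b') :
    Integrable (fun p : (ℝ × E) × (ℝ × E) => D p.1 * (backKernel κ (p.1 - p.2) * uncurry Θ p.2))
      ((volume : Measure (ℝ × E)).prod volume) := by
  obtain ⟨M, hM0, hM⟩ := hΘ.exists_norm_le
  obtain ⟨a, c, hac⟩ := hΘ.exists_time_support
  have hΘm : AEStronglyMeasurable (uncurry Θ) (volume : Measure (ℝ × E)) :=
    hΘ.contDiff.continuous.aestronglyMeasurable
  have hΘM : ∀ᵐ z ∂(volume : Measure (ℝ × E)), |uncurry Θ z| ≤ M :=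
    Eventually.of_forall fun z => by rw [← Real.norm_eq_abs]; exact hM z.1 z.2
  have hΘsupp : ∀ᵐ z ∂(volume : Measure (ℝ × E)), uncurry Θ z ≠ 0 → z.1 ∈ Icc a c :=
    Eventually.of_forall fun z hz => by
      by_contra h
      exact hz (by simp only [uncurry]; rw [hac z.1 h]; rfl)
  -- the reflected pairing is the bounded-data one
  have h := hK.reflect.integrable_kernelPairing hΘm hM0 hΘM hΘsupp hD hDsupp
  refine (h.swap).congr (Eventually.of_forall fun p => ?_)
  simp only [Function.comp_apply, Prod.fst_swap, Prod.snd_swap, neg_sub]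
  ring

/-- **The duality pairing with an integrable datum**: for a slice-bound backward kernel
`K = backKernel κ`, a space–time test function `Θ` and integrable data `D` with bounded time
support, `∫ D · (K ⋆ Θ̃) = ∫ Θ̃ · (fwdKernel κ ⋆ D)` (Fubini). [folklore] -/
theorem integral_mul_conv_eq_integral_test_mul_fwd {κ : ℝ → E → ℝ} {N : ℝ → ℝ}
    (hK : IsSliceBoundKernel (backKernel κ) N) {Θ : ℝ → E → ℝ}
    (hΘ : IsSpaceTimeTestOn (⊤ : Opens (ℝ × E)) Θ) {D : ℝ × E → ℝ}
    (hD : Integrable D (volume : Measure (ℝ × E))) {a' b' : ℝ}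
    (hDsupp : ∀ q, D q ≠ 0 → q.1 ∈ Icc a' b') :
    ∫ q, D q * (backKernel κ ⋆[ContinuousLinearMap.lsmul ℝ ℝ, (volume : Measure (ℝ × E))] uncurry Θ) q =
      ∫ q, uncurry Θ q *
        (fwdKernel κ ⋆[ContinuousLinearMap.lsmul ℝ ℝ, (volume : Measure (ℝ × E))] D) q := by
  rw [fwdKernel_eq_reflect]
  exact integral_mul_convolution_comm (integrable_pairing_of_integrable_data hK hΘ hD hDsupp)

/-! ### The representation identity, tested: `∫ φ w Θ = ∫ Θ̃ (Φ ⋆ H) - Σᵢ ∫ Θ̃ (Φᵢ ⋆ Fᵢ)` -/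

/-- **The localised solution is a sum of forward heat potentials, in the sense of
distributions** (RRS 2016, (D.2): `W = (∂ₜ - Δ)⁻¹(RHS)`, here by duality): with
`Φ = fwdKernel G` the forward heat kernel and `Φᵢ = fwdKernel (∂ᵢG)` its gradient kernels, for
every `Θ ∈ C_c^∞(ℝ × E)`,
`∫ φ w Θ̃ = ∫ Θ̃ · (Φ ⋆ locH) - Σᵢ ∫ Θ̃ · (Φᵢ ⋆ locFᵢ)` (`integral_cutoff_mul_mul_test_eq`, the
potential representations `𝒰[Θ] = backKernel G ⋆ Θ̃`, `∂ᵢ𝒰[Θ] = backKernel (∂ᵢG) ⋆ Θ̃` of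
`CaloricDuhamelRepresentation`, and Fubini). [cite: RobinsonRodrigoSadowskiCUP2016, App. D (D.2) with §13.3.2 Step 1 (13.11)–(13.12)] -/
theorem integral_cutoff_mul_mul_test_eq_potentials (b : OrthonormalBasis ι ℝ E) {Q : Opens (ℝ × E)}
    {w : ℝ × E → ℝ} {g : ℝ × E → E} (hw : Integrable w (volume : Measure (ℝ × E)))
    (hg : Integrable g (volume : Measure (ℝ × E)))
    (heq : ∀ ψ : ℝ → E → ℝ, IsSpaceTimeTestOn Q ψ →
      ∫ q : ℝ × E, w q * (timeDeriv ψ q.1 q.2 + (Δ (ψ q.1)) q.2) =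
        ∫ q : ℝ × E, ⟪g q, gradient (ψ q.1) q.2⟫)
    {φ : ℝ → E → ℝ} (hφ : IsSpaceTimeTestOn Q φ) {Θ : ℝ → E → ℝ}
    (hΘ : IsSpaceTimeTestOn (⊤ : Opens (ℝ × E)) Θ) :
    ∫ q : ℝ × E, φ q.1 q.2 * w q * Θ q.1 q.2 =
      (∫ q : ℝ × E, uncurry Θ q *
        (fwdKernel (UnboundedOperators.heatKernel (E := E))
          ⋆[ContinuousLinearMap.lsmul ℝ ℝ, (volume : Measure (ℝ × E))] locH b φ w g) q) -
      ∑ i, ∫ q : ℝ × E, uncurry Θ q *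
        (fwdKernel (heatKernelGrad (b i))
          ⋆[ContinuousLinearMap.lsmul ℝ ℝ, (volume : Measure (ℝ × E))] locF b φ w g i) q := by
  rw [integral_cutoff_mul_mul_test_eq b hw hg heq hφ hΘ]
  obtain ⟨a', b', hab'⟩ := exists_time_bounds_of_isSpaceTimeTestOn hφ
  have hHsupp : ∀ q, locH b φ w g q ≠ 0 → q.1 ∈ Icc a' b' := fun q hq =>
    hab' q (by by_contra h; exact hq (locH_eq_zero_of_notMem b w g h))
  have hFsupp : ∀ i q, locF b φ w g i q ≠ 0 → q.1 ∈ Icc a' b' := fun i q hq =>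
    hab' q (by by_contra h; exact hq (locF_eq_zero_of_notMem b w g i h))
  have e1 : ∫ q : ℝ × E, locH b φ w g q * heatDuhamelBack 1 Θ q.1 q.2 =
      ∫ q : ℝ × E, uncurry Θ q *
        (fwdKernel (UnboundedOperators.heatKernel (E := E))
          ⋆[ContinuousLinearMap.lsmul ℝ ℝ, (volume : Measure (ℝ × E))] locH b φ w g) q := by
    rw [← integral_mul_conv_eq_integral_test_mul_fwd isSliceBoundKernel_backKernel_heatKernel hΘ
      (integrable_locH b hφ hw hg) hHsupp]
    refine integral_congr_ae (Eventually.of_forall fun q => ?_)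
    simp only
    rw [heatDuhamelBack_one_eq_convolution_heatKernel hΘ q.1 q.2]
  have e2 : ∀ i, ∫ q : ℝ × E, locF b φ w g i q * fderiv ℝ (heatDuhamelBack 1 Θ q.1) q.2 (b i) =
      ∫ q : ℝ × E, uncurry Θ q *
        (fwdKernel (heatKernelGrad (b i))
          ⋆[ContinuousLinearMap.lsmul ℝ ℝ, (volume : Measure (ℝ × E))] locF b φ w g i) q := by
    intro i
    rw [← integral_mul_conv_eq_integral_test_mul_fwd (isSliceBoundKernel_backKernel_heatKernelGrad (b i))
      hΘ (integrable_locF b hφ hw hg i) (hFsupp i)]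
    refine integral_congr_ae (Eventually.of_forall fun q => ?_)
    simp only
    rw [fderiv_heatDuhamelBack_one_eq_convolution_heatKernelGrad hΘ q.1 q.2 (b i)]
  rw [e1, Finset.sum_congr rfl fun i _ => e2 i]

/-! ### Truncation of the kernels in time -/

/-- **Only a bounded time window of the kernel is seen**: if the test function lives in
`{t < c}` and the datum has time support in `[a', b']`, the forward potential may be computed with
the kernel truncated at any `T ≥ c - a'`. [folklore] -/
theorem integral_test_mul_fwd_eq_fwdCut {κ : ℝ → E → ℝ} {θ : ℝ × E → ℝ} {c : ℝ}
    (hθ : ∀ q, θ q ≠ 0 → q.1 < c) {D : ℝ × E → ℝ} {a' b' : ℝ} (hDsupp : ∀ q, D q ≠ 0 → q.1 ∈ Icc a' b')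
    {T : ℝ} (hT : c - a' ≤ T) :
    ∫ q, θ q * (fwdKernel κ ⋆[ContinuousLinearMap.lsmul ℝ ℝ, (volume : Measure (ℝ × E))] D) q =
      ∫ q, θ q * (fwdKernelCut κ T ⋆[ContinuousLinearMap.lsmul ℝ ℝ, (volume : Measure (ℝ × E))] D) q := by
  refine integral_congr_ae (Eventually.of_forall fun q => ?_)
  simp only
  by_cases hq : θ q = 0
  · simp [hq]
  · have hqc := hθ q hq
    congr 1
    rw [convolution_def, convolution_def]
    refine integral_congr_ae (Eventually.of_forall fun v => ?_)
    simp only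
    by_cases hD : D (q - v) = 0
    · simp [hD]
    · have h1 := hDsupp _ hD
      have hv : v.1 < T := by
        have : (q - v).1 = q.1 - v.1 := rfl
        rw [this] at h1
        linarith [h1.1]
      rw [fwdKernelCut_of_lt κ hv]

/-! ### `L^m` data times bounded compactly supported factors -/

/-- `MemLp` is preserved by multiplication with a continuous compactly supported function. [folklore] -/
theorem memLp_mul_of_continuous_hasCompactSupport {m c : ℝ × E → ℝ} {p : ℝ≥0∞}
    (hm : MemLp m p (volume : Measure (ℝ × E))) (hc : Continuous c) (hcs : HasCompactSupport c) :
    MemLp (fun q => m q * c q) p (volume : Measure (ℝ × E)) := by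
  obtain ⟨C, hC⟩ := hc.bounded_above_of_compact_support hcs
  refine hm.of_le_mul (hm.1.mul hc.aestronglyMeasurable) (c := C) (Eventually.of_forall fun q => ?_)
  rw [norm_mul, mul_comm]
  exact mul_le_mul_of_nonneg_right (hC q) (norm_nonneg _)

/-- Coordinates of an `L^p` vector field are in `L^p`. [folklore] -/
theorem memLp_inner_const {g : ℝ × E → E} {p : ℝ≥0∞} (hg : MemLp g p (volume : Measure (ℝ × E)))
    (v : E) : MemLp (fun q => ⟪g q, v⟫) p (volume : Measure (ℝ × E)) := by
  refine hg.of_le_mul (hg.1.inner aestronglyMeasurable_const) (c := ‖v‖)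
    (Eventually.of_forall fun q => ?_)
  rw [mul_comm]
  exact norm_inner_le_norm _ _

/-- The localised scalar datum inherits `L^p`. [folklore] -/
theorem memLp_locH (b : OrthonormalBasis ι ℝ E) {Q : Opens (ℝ × E)} {φ : ℝ → E → ℝ}
    (hφ : IsSpaceTimeTestOn Q φ) {w : ℝ × E → ℝ} {g : ℝ × E → E} {p : ℝ≥0∞}
    (hw : MemLp w p (volume : Measure (ℝ × E))) (hg : MemLp g p (volume : Measure (ℝ × E))) :
    MemLp (locH b φ w g) p (volume : Measure (ℝ × E)) := by
  have hφs : ContDiff ℝ ((⊤ : ℕ∞) : WithTop ℕ∞) (uncurry φ) := hφ.contDiff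
  have cdφ : ∀ i, Continuous fun q : ℝ × E => fderiv ℝ (φ q.1) q.2 (b i) := fun i =>
    continuous_fderiv_slice_apply_of_contDiff hφs (b i)
  have cχ : Continuous fun q : ℝ × E => timeDeriv φ q.1 q.2 + (Δ (φ q.1)) q.2 :=
    (continuous_timeDeriv_of_contDiff hφs).add (continuous_laplacian_slice_of_contDiff hφs)
  have sdφ : ∀ i, HasCompactSupport fun q : ℝ × E => fderiv ℝ (φ q.1) q.2 (b i) := fun i =>
    ((hφ.mono le_top).fderiv_apply_top (b i)).hasCompactSupport
  have sχ : HasCompactSupport fun q : ℝ × E => timeDeriv φ q.1 q.2 + (Δ (φ q.1)) q.2 :=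
    (hφ.mono le_top).timeDeriv_top.hasCompactSupport.add (hφ.mono le_top).laplacian_top.hasCompactSupport
  have I1 : MemLp (fun q : ℝ × E => w q * (timeDeriv φ q.1 q.2 + (Δ (φ q.1)) q.2)) p
      (volume : Measure (ℝ × E)) := memLp_mul_of_continuous_hasCompactSupport hw cχ sχ
  have I2 : ∀ i, MemLp (fun q : ℝ × E => ⟪g q, b i⟫ * fderiv ℝ (φ q.1) q.2 (b i)) p
      (volume : Measure (ℝ × E)) := fun i =>
    memLp_mul_of_continuous_hasCompactSupport (memLp_inner_const hg (b i)) (cdφ i) (sdφ i)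
  exact I1.sub (memLp_finsetSum _ fun i _ => I2 i)

/-- The localised vector data inherit `L^p`. [folklore] -/
theorem memLp_locF (b : OrthonormalBasis ι ℝ E) {Q : Opens (ℝ × E)} {φ : ℝ → E → ℝ}
    (hφ : IsSpaceTimeTestOn Q φ) {w : ℝ × E → ℝ} {g : ℝ × E → E} {p : ℝ≥0∞}
    (hw : MemLp w p (volume : Measure (ℝ × E))) (hg : MemLp g p (volume : Measure (ℝ × E)))
    (i : ι) : MemLp (locF b φ w g i) p (volume : Measure (ℝ × E)) := by
  have hφs : ContDiff ℝ ((⊤ : ℕ∞) : WithTop ℕ∞) (uncurry φ) := hφ.contDiff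
  have cφ : Continuous fun q : ℝ × E => φ q.1 q.2 := hφs.continuous
  have cdφ : Continuous fun q : ℝ × E => fderiv ℝ (φ q.1) q.2 (b i) :=
    continuous_fderiv_slice_apply_of_contDiff hφs (b i)
  have sφ : HasCompactSupport fun q : ℝ × E => φ q.1 q.2 := hφ.hasCompactSupport
  have sdφ : HasCompactSupport fun q : ℝ × E => fderiv ℝ (φ q.1) q.2 (b i) :=
    ((hφ.mono le_top).fderiv_apply_top (b i)).hasCompactSupport
  have I1 : MemLp (fun q : ℝ × E => ⟪g q, b i⟫ * φ q.1 q.2) p (volume : Measure (ℝ × E)) :=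
    memLp_mul_of_continuous_hasCompactSupport (memLp_inner_const hg (b i)) cφ sφ
  have I2 : MemLp (fun q : ℝ × E => w q * fderiv ℝ (φ q.1) q.2 (b i)) p (volume : Measure (ℝ × E)) :=
    memLp_mul_of_continuous_hasCompactSupport hw cdφ sdφ
  refine (I1.sub (I2.const_mul 2)).ae_eq (Eventually.of_forall fun q => ?_)
  simp only [locF, Pi.sub_apply]
  ring

end General

/-! ## The improvement in `ℝ³` -/

section R3

/-- Local notation for physical space `ℝ³ = EuclideanSpace ℝ (Fin 3)`. -/
local notation "ℝ³" => EuclideanSpace ℝ (Fin 3)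

/-- **The Young exponent of one improvement round.** For `1 < m ≤ r` with `1/m < 1/r + 1/5`
there is `p ∈ [1, 5/4)` with `1/p + 1/m = 1 + 1/r` (so the kernel gradient, which is in `L^p`
for `p < 5/4`, improves `L^m` data to an `L^r` potential by Young's inequality). [folklore] -/
theorem exists_kernel_exponent {m r : ℝ≥0∞} (h1 : 1 < m) (hmr : m ≤ r) (hexp : m⁻¹ < r⁻¹ + 5⁻¹) :
    ∃ p : ℝ≥0∞, 1 ≤ p ∧ p ≠ ⊤ ∧ p.toReal < 5 / 4 ∧ p⁻¹ + m⁻¹ = 1 + r⁻¹ := by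
  have hm0 : m ≠ 0 := (zero_lt_one.trans h1).ne'
  have hr0 : r ≠ 0 := (zero_lt_one.trans (h1.trans_le hmr)).ne'
  have hmi : m⁻¹ ≠ ⊤ := ENNReal.inv_ne_top.2 hm0
  have hri : r⁻¹ ≠ ⊤ := ENNReal.inv_ne_top.2 hr0
  set mi : ℝ := m⁻¹.toReal with hmi_def
  set ri : ℝ := r⁻¹.toReal with hri_def
  have emi : m⁻¹ = ENNReal.ofReal mi := (ENNReal.ofReal_toReal hmi).symm
  have eri : r⁻¹ = ENNReal.ofReal ri := (ENNReal.ofReal_toReal hri).symm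
  have hmi0 : 0 ≤ mi := ENNReal.toReal_nonneg
  have hri0 : 0 ≤ ri := ENNReal.toReal_nonneg
  -- the hypotheses in real form
  have hmi1 : mi < 1 := by
    have h : m⁻¹ < 1 := ENNReal.inv_lt_one.2 h1
    have h2 := (ENNReal.toReal_lt_toReal hmi ENNReal.one_ne_top).2 h
    rw [ENNReal.toReal_one] at h2
    exact h2
  have hrm : ri ≤ mi := (ENNReal.toReal_le_toReal hri hmi).2 (ENNReal.inv_le_inv.2 hmr)
  have h5 : mi < ri + 1 / 5 := by
    have h5top : (5⁻¹ : ℝ≥0∞) ≠ ⊤ := ENNReal.inv_ne_top.2 (by norm_num)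
    have hfin : r⁻¹ + 5⁻¹ ≠ ⊤ := ENNReal.add_ne_top.2 ⟨hri, h5top⟩
    have h2 := (ENNReal.toReal_lt_toReal hmi hfin).2 hexp
    have e5 : (5⁻¹ : ℝ≥0∞).toReal = 1 / 5 := by
      rw [ENNReal.toReal_inv]; norm_num
    rw [ENNReal.toReal_add hri h5top, e5] at h2
    exact h2
  -- the exponent
  set d : ℝ := 1 + ri - mi with hd
  have hd0 : 0 < d := by rw [hd]; linarith
  refine ⟨ENNReal.ofReal (1 / d), ?_, ENNReal.ofReal_ne_top, ?_, ?_⟩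
  · rw [ENNReal.one_le_ofReal, le_div_iff₀ hd0]
    rw [hd]; linarith
  · rw [ENNReal.toReal_ofReal (by positivity), div_lt_div_iff₀ hd0 (by norm_num)]
    rw [hd]; linarith
  · rw [one_div, ENNReal.ofReal_inv_of_pos hd0, inv_inv, emi, eri,
      ← ENNReal.ofReal_add hd0.le hmi0, ← ENNReal.ofReal_one, ← ENNReal.ofReal_add zero_le_one hri0]
    congr 1
    rw [hd]; ring

/-- **A smooth cut-off between two centred parabolic cylinders**: for `0 < ρ' < ρ` there is
`φ ∈ C_c^∞(Q*_ρ(z))` with `φ = 1` on `Q*_{ρ'}(z)` (a product of Mathlib bump functions in time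
and space). [folklore] -/
theorem exists_cylinder_cutoff {ρ ρ' : ℝ} (hρ' : 0 < ρ') (h : ρ' < ρ) (z : ℝ × ℝ³) :
    ∃ φ : ℝ → ℝ³ → ℝ, IsSpaceTimeTestOn (parabolicCylinderCenteredOpens ρ z) φ ∧
      ∀ q ∈ parabolicCylinderCentered ρ' z, φ q.1 q.2 = 1 := by
  have hρ : 0 < ρ := hρ'.trans h
  have hsq : ρ' ^ 2 < ρ ^ 2 := by nlinarith
  -- the two bumps
  let ζ : ContDiffBump z.1 := ⟨ρ' ^ 2, (ρ' ^ 2 + ρ ^ 2) / 2, by positivity, by linarith⟩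
  let θ : ContDiffBump z.2 := ⟨ρ', (ρ' + ρ) / 2, hρ', by linarith⟩
  refine ⟨fun t x => ζ t * θ x, ⟨?_, ?_, ?_⟩, ?_⟩
  · exact (ζ.contDiff.comp contDiff_fst).mul (θ.contDiff.comp contDiff_snd)
  · refine HasCompactSupport.intro ((isCompact_closedBall z.1 ζ.rOut).prod
      (isCompact_closedBall z.2 θ.rOut)) fun q hq => ?_
    simp only [uncurry, mem_prod, not_and_or] at hq ⊢
    rcases hq with h1 | h2
    · have : ζ q.1 = 0 := by
        have h1' : q.1 ∉ Function.support (ζ : ℝ → ℝ) := by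
          rw [ζ.support_eq]; exact fun h => h1 (ball_subset_closedBall h)
        simpa [Function.mem_support] using h1'
      rw [this, zero_mul]
    · have : θ q.2 = 0 := by
        have h2' : q.2 ∉ Function.support (θ : ℝ³ → ℝ) := by
          rw [θ.support_eq]; exact fun h => h2 (ball_subset_closedBall h)
        simpa [Function.mem_support] using h2'
      rw [this, mul_zero]
  · -- `tsupport ⊆ closedBall × closedBall ⊆ Q*_ρ`
    have hsub : Function.support (uncurry fun t x => ζ t * θ x) ⊆
        closedBall z.1 ζ.rOut ×ˢ closedBall z.2 θ.rOut := by
      intro q hq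
      rw [Function.mem_support] at hq
      simp only [uncurry] at hq
      have h1 : ζ q.1 ≠ 0 := left_ne_zero_of_mul hq
      have h2 : θ q.2 ≠ 0 := right_ne_zero_of_mul hq
      have h1' : q.1 ∈ Function.support (ζ : ℝ → ℝ) := h1
      have h2' : q.2 ∈ Function.support (θ : ℝ³ → ℝ) := h2
      rw [ζ.support_eq] at h1'
      rw [θ.support_eq] at h2'
      exact ⟨ball_subset_closedBall h1', ball_subset_closedBall h2'⟩
    refine (closure_minimal hsub ((isClosed_closedBall).prod isClosed_closedBall)).trans ?_
    rintro ⟨t, x⟩ ⟨ht, hx⟩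
    rw [mem_closedBall, Real.dist_eq] at ht
    rw [mem_closedBall] at hx
    change (t, x) ∈ parabolicCylinderCentered ρ z
    rw [mem_parabolicCylinderCentered]
    have hζ : ζ.rOut = (ρ' ^ 2 + ρ ^ 2) / 2 := rfl
    have hθ : θ.rOut = (ρ' + ρ) / 2 := rfl
    rw [hζ] at ht
    rw [hθ] at hx
    refine ⟨⟨?_, ?_⟩, ?_⟩
    · have := (abs_le.1 ht).1; linarith
    · have := (abs_le.1 ht).2; linarith
    · exact hx.trans_lt (by linarith)
  · rintro ⟨t, x⟩ hq
    rw [mem_parabolicCylinderCentered] at hq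
    have h1 : ζ t = 1 := ζ.one_of_mem_closedBall (by
      rw [mem_closedBall, Real.dist_eq]
      change |t - z.1| ≤ ρ' ^ 2
      exact (abs_sub_lt_iff.2 ⟨by linarith [hq.1.2], by linarith [hq.1.1]⟩).le)
    have h2 : θ x = 1 := θ.one_of_mem_closedBall (by
      rw [mem_closedBall]
      exact hq.2.le)
    simp [h1, h2]

/-- **Discharge of the named fact `HeatDivFormInteriorImprovement`** (Robinson–Rodrigo–Sadowski
2016, proof of Thm. 13.7, §13.3.2 Step 2 with Thms. D.6–D.7, isotropic exponents). Let
`w, g ∈ L^m(Q*_ρ(z))` solve `∂ₜw - Δw = div g` weakly on `Q*_ρ(z)`, `1 < m ≤ r`, `1/m < 1/r + 1/5`,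
`0 < ρ' < ρ`. Extend `w, g` by zero; with a cut-off `φ ∈ C_c^∞(Q*_ρ)`, `φ = 1` on `Q*_{ρ'}`
(`exists_cylinder_cutoff`), the localised `W = φw` satisfies, against every `Θ ∈ C_c^∞(ℝ × ℝ³)`,
`∫ W Θ̃ = ∫ Θ̃ (Φ ⋆ H - Σᵢ Φᵢ ⋆ Fᵢ)` with `H = w(∂ₜφ + Δφ) - ⟪g, ∇φ⟫`, `F = φg - 2w∇φ ∈ L^m`
(`integral_cutoff_mul_mul_test_eq_potentials`: RRS (13.11)–(13.12) tested against the backward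
caloric Duhamel integral `𝒰[Θ]`, and the Duhamel representation (D.2) by Fubini); on the
half-space `{t < c}` containing the cylinder the forward kernels may be truncated in time
(`integral_test_mul_fwd_eq_fwdCut`), the truncated heat kernel and its gradient are in
`L^p(ℝ × ℝ³)` for the exponent `p ∈ [1, 5/4)` with `1/p + 1/m = 1 + 1/r`
(`memLp_fwdKernelCut_heatKernel[Grad]`, `exists_kernel_exponent` — the isotropic case of RRS
Thms. D.6–D.7), so the potentials are in `L^r` by Young's inequality
(`Convolution.memLp_convolution_of_memLp`); hence `W` agrees a.e. on `{t < c}` with an `L^r`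
function (du Bois-Reymond, `IsOpen.ae_eq_zero_of_integral_contDiff_smul_eq_zero`), and `w = W` on
`Q*_{ρ'}(z)`. [cite: RobinsonRodrigoSadowskiCUP2016, §13.3.2 Step 2 ((13.11)–(13.16)) with Thms. D.6–D.7 (isotropic case) and (D.2)] -/
theorem _root_.Literature.Analysis.FluidPDE.HeatDivFormInteriorImprovement_holds :
    HeatDivFormInteriorImprovement := by
  intro m r z ρ ρ' h1m hmr hexp hρ'0 hρ'ρ w g hw hg heq
  haveI := isAddLeftInvariant_volume_real_prod (E := ℝ³)
  haveI := isAddRightInvariant_volume_real_prod (E := ℝ³)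
  haveI := isNegInvariant_volume_real_prod (E := ℝ³)
  set Qs : Set (ℝ × ℝ³) := parabolicCylinderCentered ρ z with hQs
  set Qo : Opens (ℝ × ℝ³) := parabolicCylinderCenteredOpens ρ z with hQo
  have hQmeas : MeasurableSet Qs := (isOpen_parabolicCylinderCentered ρ z).measurableSet
  have hQfin : volume Qs < ⊤ := NSSpinHeat.volume_parabolicCylinderCentered_lt_top ρ z
  haveI : IsFiniteMeasure ((volume : Measure (ℝ × ℝ³)).restrict Qs) := isFiniteMeasure_restrict.2 hQfin.ne
  have hm1 : 1 ≤ m := h1m.le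
  have hr1 : 1 ≤ r := hm1.trans hmr
  -- Step A: extension by zero
  set w' : ℝ × ℝ³ → ℝ := Qs.indicator w with hw'
  set g' : ℝ × ℝ³ → ℝ³ := Qs.indicator g with hg'
  have hw'm : MemLp w' m (volume : Measure (ℝ × ℝ³)) := (memLp_indicator_iff_restrict hQmeas).2 hw
  have hg'm : MemLp g' m (volume : Measure (ℝ × ℝ³)) := (memLp_indicator_iff_restrict hQmeas).2 hg
  have hw'i : Integrable w' (volume : Measure (ℝ × ℝ³)) :=
    IntegrableOn.integrable_indicator (hw.integrable hm1) hQmeas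
  have hg'i : Integrable g' (volume : Measure (ℝ × ℝ³)) :=
    IntegrableOn.integrable_indicator (hg.integrable hm1) hQmeas
  have heq' : ∀ ψ : ℝ → ℝ³ → ℝ, IsSpaceTimeTestOn Qo ψ →
      ∫ q : ℝ × ℝ³, w' q * (timeDeriv ψ q.1 q.2 + (Δ (ψ q.1)) q.2) =
        ∫ q : ℝ × ℝ³, ⟪g' q, gradient (ψ q.1) q.2⟫ := by
    intro ψ hψ
    have e1 : (fun q : ℝ × ℝ³ => w' q * (timeDeriv ψ q.1 q.2 + (Δ (ψ q.1)) q.2)) =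
        fun q => w q * (timeDeriv ψ q.1 q.2 + (Δ (ψ q.1)) q.2) := by
      funext q
      by_cases hq : q ∈ Qs
      · rw [hw', indicator_of_mem hq]
      · have hq' : q ∉ tsupport (uncurry ψ) := fun h => hq (hψ.tsupport_subset h)
        rw [IsSpaceTimeTestOn.timeDeriv_eq_zero_of_notMem (ψ := ψ) (t := q.1) (x := q.2) hq',
          laplacian_slice_eq_zero_of_notMem_tsupport (ψ := ψ) (t := q.1) (x := q.2) hq']
        simp
    have e2 : (fun q : ℝ × ℝ³ => ⟪g' q, gradient (ψ q.1) q.2⟫) =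
        fun q => ⟪g q, gradient (ψ q.1) q.2⟫ := by
      funext q
      by_cases hq : q ∈ Qs
      · rw [hg', indicator_of_mem hq]
      · have hq' : q ∉ tsupport (uncurry ψ) := fun h => hq (hψ.tsupport_subset h)
        rw [hψ.continuous_gradient_field.2.2 q hq']
        simp
    rw [e1, e2]
    exact heq ψ hψ
  -- Step B: the cut-off and the localised data
  obtain ⟨φ, hφ, hφ1⟩ := exists_cylinder_cutoff hρ'0 hρ'ρ z
  obtain ⟨a', b', hab'⟩ := exists_time_bounds_of_isSpaceTimeTestOn hφ
  set bs := stdOrthonormalBasis ℝ ℝ³ with hbs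
  set H : ℝ × ℝ³ → ℝ := locH bs φ w' g' with hH
  set F : Fin (Module.finrank ℝ ℝ³) → ℝ × ℝ³ → ℝ := fun i => locF bs φ w' g' i with hF
  have hHm : MemLp H m (volume : Measure (ℝ × ℝ³)) := memLp_locH bs hφ hw'm hg'm
  have hFm : ∀ i, MemLp (F i) m (volume : Measure (ℝ × ℝ³)) := fun i => memLp_locF bs hφ hw'm hg'm i
  have hHsupp : ∀ q, H q ≠ 0 → q.1 ∈ Icc a' b' := fun q hq =>
    hab' q (by by_contra h'; exact hq (locH_eq_zero_of_notMem bs w' g' h'))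
  have hFsupp : ∀ i q, F i q ≠ 0 → q.1 ∈ Icc a' b' := fun i q hq =>
    hab' q (by by_contra h'; exact hq (locF_eq_zero_of_notMem bs w' g' i h'))
  -- Step C: the kernels and the potentials
  obtain ⟨p, hp1, hptop, hp54, hpm⟩ := exists_kernel_exponent h1m hmr hexp
  set c : ℝ := z.1 + ρ ^ 2 + 1 with hc
  set T : ℝ := c - a' with hT
  have hd3 : Module.finrank ℝ ℝ³ = 3 := by simp
  have hK0 : MemLp (fwdKernelCut (UnboundedOperators.heatKernel (E := ℝ³)) T) p
      (volume : Measure (ℝ × ℝ³)) :=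
    memLp_fwdKernelCut_heatKernel T hp1 hptop (by
      rw [hd3]; norm_num; linarith)
  have hKi : ∀ i, MemLp (fwdKernelCut (heatKernelGrad (bs i)) T) p (volume : Measure (ℝ × ℝ³)) :=
    fun i => memLp_fwdKernelCut_heatKernelGrad (bs i) T hp1 hptop (by
      rw [hd3]; norm_num; linarith)
  set P0 : ℝ × ℝ³ → ℝ := fwdKernelCut (UnboundedOperators.heatKernel (E := ℝ³)) T
    ⋆[ContinuousLinearMap.lsmul ℝ ℝ, (volume : Measure (ℝ × ℝ³))] H with hP0
  set Pi : Fin (Module.finrank ℝ ℝ³) → ℝ × ℝ³ → ℝ := fun i =>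
    fwdKernelCut (heatKernelGrad (bs i)) T ⋆[ContinuousLinearMap.lsmul ℝ ℝ, (volume : Measure (ℝ × ℝ³))] F i
    with hPi
  have hP0m : MemLp P0 r (volume : Measure (ℝ × ℝ³)) :=
    Convolution.memLp_convolution_of_memLp hp1 hm1 hpm hK0 hHm
  have hPim : ∀ i, MemLp (Pi i) r (volume : Measure (ℝ × ℝ³)) := fun i =>
    Convolution.memLp_convolution_of_memLp hp1 hm1 hpm (hKi i) (hFm i)
  set V : ℝ × ℝ³ → ℝ := fun q => P0 q - ∑ i, Pi i q with hV
  have hVm : MemLp V r (volume : Measure (ℝ × ℝ³)) := hP0m.sub (memLp_finsetSum _ fun i _ => hPim i)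
  have hVloc : LocallyIntegrable V (volume : Measure (ℝ × ℝ³)) := hVm.locallyIntegrable hr1
  have hP0loc : LocallyIntegrable P0 (volume : Measure (ℝ × ℝ³)) := hP0m.locallyIntegrable hr1
  have hPiloc : ∀ i, LocallyIntegrable (Pi i) (volume : Measure (ℝ × ℝ³)) := fun i =>
    (hPim i).locallyIntegrable hr1
  -- the localised solution
  set W : ℝ × ℝ³ → ℝ := fun q => φ q.1 q.2 * w' q with hW
  have hWi : Integrable W (volume : Measure (ℝ × ℝ³)) := by
    have h : Integrable (fun q : ℝ × ℝ³ => w' q * φ q.1 q.2) (volume : Measure (ℝ × ℝ³)) :=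
      integrable_mul_of_continuous_hasCompactSupport hw'i hφ.contDiff.continuous hφ.hasCompactSupport
    refine h.congr (Eventually.of_forall fun q => ?_)
    simp only [hW]; ring
  -- Step D: the tested identity on the half-space `{t < c}`
  set O : Set (ℝ × ℝ³) := {q | q.1 < c} with hO
  have hOo : IsOpen O := isOpen_lt continuous_fst continuous_const
  have hid : ∀ θ : ℝ × ℝ³ → ℝ, ContDiff ℝ ((⊤ : ℕ∞) : WithTop ℕ∞) θ → HasCompactSupport θ →
      tsupport θ ⊆ O →
      ∫ q, θ q • (W q - V q) = 0 := by
    intro θ hθs hθc hθO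
    set Θ : ℝ → ℝ³ → ℝ := fun t x => θ (t, x) with hΘ
    have hΘe : uncurry Θ = θ := rfl
    have hΘt : IsSpaceTimeTestOn (⊤ : Opens (ℝ × ℝ³)) Θ := ⟨hθs, hθc, by simp⟩
    have key := integral_cutoff_mul_mul_test_eq_potentials bs hw'i hg'i heq' hφ hΘt
    rw [hΘe] at key
    have hθ0 : ∀ q, θ q ≠ 0 → q.1 < c := fun q hq => hθO (subset_tsupport _ hq)
    have t0 := integral_test_mul_fwd_eq_fwdCut (κ := UnboundedOperators.heatKernel (E := ℝ³)) hθ0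
      hHsupp (T := T) le_rfl
    have ti := fun i => integral_test_mul_fwd_eq_fwdCut (κ := heatKernelGrad (bs i)) hθ0
      (hFsupp i) (T := T) le_rfl
    rw [t0, Finset.sum_congr rfl fun i _ => ti i] at key
    -- integrability of `θ · (potential)`
    have I0 : Integrable (fun q => θ q * P0 q) (volume : Measure (ℝ × ℝ³)) :=
      hP0loc.integrable_smul_left_of_hasCompactSupport hθs.continuous hθc
    have Ii : ∀ i, Integrable (fun q => θ q * Pi i q) (volume : Measure (ℝ × ℝ³)) := fun i =>
      (hPiloc i).integrable_smul_left_of_hasCompactSupport hθs.continuous hθc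
    have IW : Integrable (fun q => θ q * W q) (volume : Measure (ℝ × ℝ³)) :=
      hWi.locallyIntegrable.integrable_smul_left_of_hasCompactSupport hθs.continuous hθc
    have eW : ∫ q, φ q.1 q.2 * w' q * θ q = ∫ q, θ q * W q := by
      refine integral_congr_ae (Eventually.of_forall fun q => ?_)
      simp only [hW]; ring
    have eV : ∫ q, θ q * V q = (∫ q, θ q * P0 q) - ∑ i, ∫ q, θ q * Pi i q := by
      rw [← integral_finsetSum _ fun i _ => Ii i, ← integral_sub I0 (integrable_finsetSum _ fun i _ => Ii i)]
      refine integral_congr_ae (Eventually.of_forall fun q => ?_)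
      simp only [hV, Finset.mul_sum, mul_sub]
    have IV : Integrable (fun q => θ q * V q) (volume : Measure (ℝ × ℝ³)) :=
      hVloc.integrable_smul_left_of_hasCompactSupport hθs.continuous hθc
    simp_rw [smul_eq_mul, mul_sub]
    rw [integral_sub IW IV, ← eW, key, eV, sub_self]
  -- Step E: `W = V` a.e. on the half-space
  have hae : ∀ᵐ q ∂(volume : Measure (ℝ × ℝ³)), q ∈ O → W q - V q = 0 :=
    hOo.ae_eq_zero_of_integral_contDiff_smul_eq_zero
      ((hWi.locallyIntegrable.sub hVloc).locallyIntegrableOn O) hid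
  -- Step F: conclusion on `Q*_{ρ'}(z)`
  have hsub : parabolicCylinderCentered ρ' z ⊆ Qs := parabolicCylinderCentered_mono hρ'0.le hρ'ρ.le z
  have hsubO : parabolicCylinderCentered ρ' z ⊆ O := by
    intro q hq
    rw [mem_parabolicCylinderCentered] at hq
    show q.1 < c
    have : ρ' ^ 2 < ρ ^ 2 := by nlinarith
    rw [hc]; linarith [hq.1.2]
  have hVr : MemLp V r ((volume : Measure (ℝ × ℝ³)).restrict (parabolicCylinderCentered ρ' z)) :=
    hVm.restrict _
  refine hVr.ae_eq ?_
  rw [Filter.EventuallyEq, ae_restrict_iff' (isOpen_parabolicCylinderCentered ρ' z).measurableSet]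
  filter_upwards [hae] with q hq hq'
  have h1 : W q - V q = 0 := hq (hsubO hq')
  have h2 : W q = w q := by
    simp only [hW, hφ1 q hq', hw', indicator_of_mem (hsub hq'), one_mul]
  linarith

end R3

end HeatDivForm

end Literature.Analysis.FluidPDE
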